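import Summits.SmoothPoincare4.SmoothPoincare4.Theorems.AcyclicBisectionExists.Negative.Witness
import Summits.SmoothPoincare4.SmoothPoincare4.Theorems.ContractibleTwistedDoubleStandard.Negative.DoubleBisection
import Literature.Topology.FourManifolds.GluingProofs

/-!
# `AcyclicBisectionExists` — negative-side support (7): the ∃-body HOLDS on every double of a
# ℚ-acyclic compact Stein domain

§13 of the standing disprover's work file `Cruxes/AcyclicBisectionExists/Disproof.lean` (gen 3):
`Witness.ofIsDouble` (a double `D(W) = W ∪_id W` of a compact Stein domain is a witness, via the
sibling crux's `steinBisection_of_glue`), `hasAcyclicSteinBisection_of_isDouble` (acyclic `W` ⇒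
the ∃-body holds on `D(W)`), `exists_double_hasAcyclicSteinBisection` (the double exists, tree
`exists_isBoundaryGluing_holds` at `φ = id`).  So the `ψ = id` sector of the EXISTENCE crux is
free — every presentation homotopy sphere `D(C)`, `C` a contractible compact Stein domain, satisfies
the crux at `M = D(C)` without deciding `D(C) ≅ S⁴` — and, on paper (`D(B_{p,q})`, `π₁ = ℤ/p`),
`HasAcyclicSteinBisection M` does not imply `M ≃ₕ S⁴`.
-/

noncomputable section

-- the prescribed namespace `Summit.<P>.<Sub>.…` duplicates `SmoothPoincare4` (P = Sub)
set_option linter.dupNamespace false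

open scoped Manifold ContDiff Topology ContinuousMap
open Set Function CategoryTheory CategoryTheory.Limits
open Literature.Geometry.Symplectic Literature.AlgebraicTopology.SingularHomology

namespace Summit.SmoothPoincare4.SmoothPoincare4.Theorems.AcyclicBisectionExists.Negative

open Summit.SmoothPoincare4.SmoothPoincare4.Theses.ConvexBisection

/-- Local notation: the model space `ℝ⁴`. -/
local notation "𝔼4" => EuclideanSpace ℝ (Fin 4)

section Doubles

open Literature.Topology.FourManifolds
open Summit.SmoothPoincare4.SmoothPoincare4.Theorems.ContractibleTwistedDoubleStandard.Negative

variable {W : Type} [TopologicalSpace W] [ChartedSpace (EuclideanHalfSpace 4) W]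
  [IsManifold (𝓡∂ 4) ∞ W] [CompactSpace W]
  {P : Type} [TopologicalSpace P] [ChartedSpace 𝔼4 P]

/-- **Every double `D(W) = W ∪_id W` of a compact Stein domain is a witness** (both halves
`(W, J)`, the two canonical embeddings; the complex tangencies agree on the seam because the two
embeddings agree along `∂W` — the sibling crux's landed `steinBisection_of_glue`,
`Theorems/ContractibleTwistedDoubleStandard/Negative/DoubleBisection.lean`). [folklore] -/
def Witness.ofIsDouble (b : BoundaryData (𝓡∂ 4) W (𝓡 3)) (S : SteinStructure W)
    (h : IsDouble b (𝓡 4) P) : Witness P :=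
  let jA := h.choose
  let jB := h.choose_spec.choose
  have H := steinBisection_of_glue b S h.choose_spec.choose_spec.1 h.choose_spec.choose_spec.2.1
    h.choose_spec.choose_spec.2.2.1 h.choose_spec.choose_spec.2.2.2
  { W₁ := W, W₂ := W, J₁ := S, J₂ := S, e₁ := jA, e₂ := jB,
    emb₁ := H.1, emb₂ := H.2.1, cover := H.2.2.1, inter₁ := H.2.2.2.1, inter₂ := H.2.2.2.2.1,
    contact := H.2.2.2.2.2 }

/-- **The ∃-body of the crux HOLDS on every double of a ℚ-acyclic compact Stein domain**: if
`H_k(W; ℚ) = 0` for `k > 0` and `P = D(W)` then `HasAcyclicSteinBisection P`.  Consequences: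
(i) the `ψ = id` sector of the EXISTENCE crux is free — every presentation homotopy sphere
`D(C) = ∂(C × I)` (`C` a contractible compact Stein domain: Mazur manifolds, Stein corks, the
Akbulut–Matveyev pieces) satisfies `AcyclicBisectionExists` at `M = D(C)` WITHOUT deciding
`D(C) ≅ S⁴` (Andrews–Curtis adjacent; that decision is the RIGIDITY crux's `double_standard_of_crux`);
(ii) ON PAPER the doubles `D(B_{p,q})` of the Stein rational homology balls are ℚ-homology
4-spheres with `π₁ = ℤ/p ≠ 1` carrying acyclic Stein bisections: `HasAcyclicSteinBisection M`
does NOT imply `M ≃ₕ S⁴`, and the rigidity crux genuinely needs its hypothesis `M ≃ₕ S⁴`.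
[folklore] -/
theorem hasAcyclicSteinBisection_of_isDouble (b : BoundaryData (𝓡∂ 4) W (𝓡 3)) (S : SteinStructure W)
    (hW : ∀ k, 0 < k → IsZero (singularHomology ℚ ℚ W k)) (h : IsDouble b (𝓡 4) P) :
    HasAcyclicSteinBisection P :=
  ⟨Witness.ofIsDouble b S h, fun k hk => ⟨hW k hk, hW k hk⟩⟩

/-- **Existence form**: every ℚ-acyclic compact (Hausdorff, second countable) Stein domain `W`
HAS a double — a closed smooth 4-manifold `P = W ∪_id W` (tree `exists_isBoundaryGluing_holds`
at `φ = id`, Bröcker–Jänich (13.11)) — and that double carries a ℚ-acyclic Stein bisection along a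
common contact seam. [folklore] -/
theorem exists_double_hasAcyclicSteinBisection [T2Space W] [SecondCountableTopology W]
    (S : SteinStructure W) (hW : ∀ k, 0 < k → IsZero (singularHomology ℚ ℚ W k)) :
    ∃ (P : Type) (_ : TopologicalSpace P) (_ : T2Space P) (_ : SecondCountableTopology P)
      (_ : CompactSpace P) (_ : ChartedSpace 𝔼4 P) (_ : IsManifold (𝓡 4) ∞ P),
      IsDouble (BoundaryManifold.boundaryData 3 W) (𝓡 4) P ∧ HasAcyclicSteinBisection P := by
  obtain ⟨P, _, _, _, _, _, _, hP⟩ :=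
    exists_isBoundaryGluing_holds (bM := BoundaryManifold.boundaryData 3 W)
      (bN := BoundaryManifold.boundaryData 3 W) (Diffeomorph.refl (𝓡 3) _ ∞)
  have hD : IsDouble (BoundaryManifold.boundaryData 3 W) (𝓡 4) P := by
    have e : (⇑(Diffeomorph.refl (𝓡 3) (BoundaryManifold.boundaryData 3 W).carrier ∞) :
        (BoundaryManifold.boundaryData 3 W).carrier → (BoundaryManifold.boundaryData 3 W).carrier) = id :=
      rfl
    rw [e] at hP
    exact hP
  exact ⟨P, ‹_›, ‹_›, ‹_›, ‹_›, ‹_›, ‹_›, hD,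
    hasAcyclicSteinBisection_of_isDouble _ S hW hD⟩

end Doubles

end Summit.SmoothPoincare4.SmoothPoincare4.Theorems.AcyclicBisectionExists.Negative
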